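import Literature.MathematicalPhysics.QuantumLattice.LiebWuThermodynamicLimit
import Literature.Analysis.SpecialFunctions.BesselJZeroFermiIntegral
import HarnessLib

/-!
# Lieb–Wu's Lemma 5: positivity and bounds of the momentum density `ρ₀` of the half-filled Hubbard chain

Family `hubbard` (trunk T-QLATTICE), statement hubbard.S10 (`lieb_wu`). For Lieb–Wu's density
`ρ₀(k) = 1/(2π) + (cos k/π) ∫₀^∞ cos(ω sin k) J₀(ω)/(1 + e^{ωU/2}) dω` (`liebWuRho0`,
`LiebWuThermodynamicLimit`) this file PROVES, for every `U > 0`,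

* `liebWuRho0_bounds_of_cos_pos`: `1/(2π) < ρ₀(k) < 1/π` where `cos k > 0`
  (printed form `liebWuRho0_bounds_of_abs_lt_pi_div_two`: `|k| < π/2`);
* `liebWuRho0_bounds_of_cos_neg`: `0 < ρ₀(k) < 1/(2π)` where `cos k < 0`
  (printed form `liebWuRho0_bounds_of_pi_div_two_lt_abs`: `π/2 < |k| ≤ π`);
* `liebWuRho0_pos`, `liebWuRho0_lt_inv_pi`: `0 < ρ₀(k) < 1/π` for all `k`.

This is Lemma 5 of E. H. Lieb, F. Y. Wu, Physica A 321 (2003) 1, §6 ("the crucial bound needed as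
input in Lemma 3": `f₀(x) < 2t(x)` for `|x| ≤ 1`, i.e. positivity of `ρ₀` beyond `|k| = π/2`). The
analysis — the inequalities `0 < I` and `2I < 1/√(1 - s²)` for
`I = ∫₀^∞ cos(sω) J₀(ω)/(1 + e^{aω}) dω`, `a = U/2`, `s = sin k` — is
`Literature.Analysis.SpecialFunctions.BesselJZeroFermiIntegral` (a real-variable proof of Lieb–Wu's
contour representation (rhoeye)); here only the translation to `ρ₀` is done
(`ρ₀ = 1/(2π) + (cos k/π) I(U/2, sin k)`, `√(1 - sin²k) = |cos k|`).

## Why this matters for F3a (`goldbaum_rootDensity_tendsto`): closing "movement 2"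

`LiebWuRootDensityLimit` reduces F3a to the identification of the subsequential weak limits
`(μ, ν)` of the empirical measures of the `k_j` and of the `Λ_α` (movement 2 of Goldbaum's §5) and
notes that the crux is a positivity statement ("`z' ≥ 0`, `w' ≥ 0` for every limit point, i.e.
Lieb–Wu's Lemma 3 for the limit system"), which Lieb–Wu prove only for interval supports. The
following argument (not formalised here; recorded for whoever discharges F3a) shows that the
present Lemma 5 — a statement about the EXPLICIT `ρ₀` only — suffices, together with two kernel
positivity facts. Notation: `K = ` Cauchy density of scale `U/4` (Fourier transform `e^{-U|ω|/4}`,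
Lieb–Wu's `K`), `K² = K∗K` (scale `U/2`), `t(x) = (2π)⁻¹(1 - x²)^{-1/2}` on `(-1, 1)`,
`Û = (1 + K²)⁻¹K²` = convolution with `u(x) = π⁻¹ ∫₀^∞ cos(ωx)/(1 + e^{ωU/2}) dω`,
`R = (1 + K²)⁻¹K` = convolution with `r`, `r̂(ω) = 1/(2 cosh(Uω/4))`; `ν` is normalised to mass
`1/2` (Lieb–Wu's `σ`), `μ_s := sin_* μ` (a probability measure on `[-1, 1]`).

1. (kernels) `u ≥ 0` because the Fermi function is convex decreasing on `(0, ∞)` (Pólya: integrate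
   by parts twice, `∫₀^∞ cos(ωx) φ(ω) dω = x⁻² ∫₀^∞ (1 - cos ωx) φ''(ω) dω`); `∫ u = 1/2` (Fourier
   inversion), so `‖Û‖_{L² → L²} ≤ 1/2`; `r > 0` (inverse transform of `sech`, e.g. from
   `|Γ(1/2 + iy)|² = π/cosh πy` which exhibits `sech` as the transform of an autocorrelation, or
   from the partial fractions of `sech`); and `(1 + K²)⁻¹ = 1 - Û`.
2. (a priori structure of limit points, from the finite equations and the ORDERING of the roots
   only) With `ψ_L(k) = k - ∫ θ(2 sin k - 2Λ) dν_L`, `χ_L(Λ) = ∫ θ(2 sin k - 2Λ) dμ_L + ∫ θ(Λ - Λ') dν_L`,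
   the Lieb–Wu equations say `ψ_L(k_j) = 2πI_j/N_a`, `χ_L(Λ_α) = 2πJ_α/N_a`; consecutive roots are
   consecutive levels, so for every interval `μ_L[a, b] ≤ ∫_a^b (ψ_L'/2π)⁺ + 1/N_a` and
   `ν_L[a, b] ≤ ∫_a^b (χ_L'/2π)⁺ + 1/N_a`. In the limit (tightness is proved in
   `LiebWuRootDensityLimit`; `ψ_L'`, `χ_L'` converge uniformly): `μ ≤ ρ̃⁺ dk`, `ν ≤ σ̃⁺ dΛ` with
   `ρ̃ = 1/2π + cos k · (K∗ν)(sin k)`, `σ̃ = K∗μ_s - K²∗ν`, and the masses match: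
   `∫ ρ̃ = 1 = μ(ℝ)`, `∫ σ̃ = 1/2 = ν(ℝ)` (from `ψ(±π)`, `χ(±∞)`).
3. (the `Λ`-part, no Lemma 5 needed) `σ̃ + K²∗σ̃ = K∗μ_s + K²∗(σ̃ - ν)`, so
   `σ̃ = R∗μ_s + Û(σ̃⁺ - ν) - Û(σ̃⁻) ≥ -Û(σ̃⁻)`, whence `σ̃⁻ ≤ Û σ̃⁻` pointwise and
   `‖σ̃⁻‖₂² ≤ ⟨σ̃⁻, Ûσ̃⁻⟩ ≤ ‖σ̃⁻‖₂²/2`: `σ̃ ≥ 0`, so `ν = σ̃ dΛ` (equal masses) and `ν = R∗μ_s`,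
   i.e. `ν̂ = μ̂_s/(2cosh(Uω/4))` — Goldbaum's "`B = ℝ`" for ANY limit point.
4. (the `k`-part, where Lemma 5 enters) Now `F := K∗ν = Û μ_s ≥ 0` and `ρ̃ = 1/2π + cos k F(sin k)`.
   Pushing `μ ≤ ρ̃⁺ dk` forward under `sin` (two branches `k`, `π - k` over each `x ∈ (-1, 1)`,
   with `ρ̃(k₁) + ρ̃(k₂) = 1/π`) gives `dμ_s/dx ≤ 2t + (F - t)⁺`. Hence
   `F ≤ Û(2t) + Û g`, `g := (F - t)⁺ 1_{[-1,1]}`, and LEMMA 5 IS EXACTLY `Û(2t) ≤ t` on `(-1, 1)`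
   (`Û(2t)(sin k) = π⁻¹ ∫₀^∞ cos(ω sin k) J₀(ω)/(1 + e^{ωU/2}) dω`, and `ρ₀ ≥ 0` for `cos k < 0`
   says `√(1 - x²) Û(2t)(x) ≤ 1/(2π)`). So `g ≤ Û g`, `g = 0` as in 3., `F ≤ t`, `ρ̃ ≥ 0`
   everywhere, `μ = ρ̃ dk` (equal masses) — Goldbaum's "`Q = [-π, π]`" — and then
   `μ_s = sin_*(ρ̃ dk) = 2t dx` (the `cos k F(sin k)` parts of the two branches cancel),
   `F = Û(2t)`, `ρ̃ = ρ₀`: every limit point is `(ρ₀ dk, σ₀ dΛ)`, which is F3a′.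

## References

* E. H. Lieb, F. Y. Wu, *The one-dimensional Hubbard model: a reminiscence*, Physica A 321 (2003)
  1–27 = arXiv:cond-mat/0207529 (held; key `LiebWuPhysicaA2003`): §5 Theorem 1, Lemma 3 and the
  remark after Theorem 1 (`ρ(π - k) = 1/π - ρ(k)`; positivity of `ρ` ⇔ `f < 2t`); §6 boxed `ρ₀`,
  (rhosum), (rhoeye), (eye), Lemma 5.
* P. S. Goldbaum, CMP 258 (2005) 317 = arXiv:cond-mat/0403736, §5 (movement 2: (5.5)–(5.15),
  "`Q = [-π, π]` and `B = ℝ`").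
-/

noncomputable section

open MeasureTheory Set Filter Real
open Literature.Analysis.FunctionSpaces Literature.Analysis.SpecialFunctions
open scoped Topology

namespace Literature.MathematicalPhysics.QuantumLattice

/-- The `ω`-integral in `ρ₀` is the Fermi-weighted integral `I(U/2, sin k)`.
[cite: LiebWuPhysicaA2003, §6, formula for ρ₀(k)] -/
theorem integral_liebWuRho0Integrand_eq_fermiCosJ0 (U k : ℝ) :
    ∫ ω in Ioi (0 : ℝ), liebWuRho0Integrand U k ω = fermiCosJ0 (U / 2) (Real.sin k) := by
  unfold fermiCosJ0 liebWuRho0Integrand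
  refine integral_congr_ae (Eventually.of_forall fun ω => ?_)
  show Real.cos (ω * Real.sin k) * besselJ 0 ω / (1 + Real.exp (ω * U / 2)) =
    Real.cos (Real.sin k * ω) * besselJ 0 ω / (1 + Real.exp (U / 2 * ω))
  rw [mul_comm ω (Real.sin k), show ω * U / 2 = U / 2 * ω by ring]

/-- `ρ₀(k) = 1/(2π) + (cos k/π) I(U/2, sin k)`. [cite: LiebWuPhysicaA2003, §6, formula for ρ₀(k)] -/
theorem liebWuRho0_eq_fermiCosJ0 (U k : ℝ) :
    liebWuRho0 U k = 1 / (2 * π) + Real.cos k / π * fermiCosJ0 (U / 2) (Real.sin k) := by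
  rw [liebWuRho0, integral_liebWuRho0Integrand_eq_fermiCosJ0]

/-- If `cos k ≠ 0` then `|sin k| < 1`. [folklore] -/
theorem abs_sin_lt_one_of_cos_ne_zero {k : ℝ} (hk : Real.cos k ≠ 0) : |Real.sin k| < 1 := by
  have h := Real.sin_sq_add_cos_sq k
  have hc : 0 < Real.cos k ^ 2 := by positivity
  have hs : Real.sin k ^ 2 < 1 := by linarith
  have hs' : |Real.sin k| ^ 2 < 1 ^ 2 := by rwa [sq_abs, one_pow]
  exact (pow_lt_pow_iff_left₀ (abs_nonneg _) zero_le_one two_ne_zero).1 hs' 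

/-- `√(1 - sin² k) = |cos k|`. [folklore] -/
theorem sqrt_one_sub_sin_sq (k : ℝ) : √(1 - Real.sin k ^ 2) = |Real.cos k| := by
  rw [← Real.cos_sq', Real.sqrt_sq_eq_abs]

/-- **Lieb–Wu 2003, Lemma 5 (first half): `1/(2π) < ρ₀(k) < 1/π` where `cos k > 0`**
(i.e. for `|k| < π/2`), for every `U > 0`. [cite: LiebWuPhysicaA2003, §6 Lemma 5] -/
theorem liebWuRho0_bounds_of_cos_pos {U k : ℝ} (hU : 0 < U) (hk : 0 < Real.cos k) :
    1 / (2 * π) < liebWuRho0 U k ∧ liebWuRho0 U k < 1 / π := by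
  have ha : 0 < U / 2 := by positivity
  have hs : |Real.sin k| < 1 := abs_sin_lt_one_of_cos_ne_zero hk.ne'
  have hF := fermiCosJ0_pos ha hs
  have h2F := two_mul_fermiCosJ0_lt ha hs
  rw [sqrt_one_sub_sin_sq, abs_of_pos hk, lt_div_iff₀ hk] at h2F
  have hπ := Real.pi_pos
  rw [liebWuRho0_eq_fermiCosJ0]
  constructor
  · have : 0 < Real.cos k / π * fermiCosJ0 (U / 2) (Real.sin k) := by positivity
    linarith
  · rw [show (1 : ℝ) / π = 1 / (2 * π) + 1 / (2 * π) by field_simp; ring, add_lt_add_iff_left,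
      div_mul_eq_mul_div, div_lt_div_iff₀ hπ (by positivity)]
    nlinarith

/-- **Lieb–Wu 2003, Lemma 5 (second half): `0 < ρ₀(k) < 1/(2π)` where `cos k < 0`**
(i.e. for `π/2 < |k| ≤ π`), for every `U > 0`. This is the positivity of the density of the
`k`'s near the zone boundary, the analytic input of Lieb–Wu's Lemma 3.
[cite: LiebWuPhysicaA2003, §6 Lemma 5] -/
theorem liebWuRho0_bounds_of_cos_neg {U k : ℝ} (hU : 0 < U) (hk : Real.cos k < 0) :
    0 < liebWuRho0 U k ∧ liebWuRho0 U k < 1 / (2 * π) := by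
  have ha : 0 < U / 2 := by positivity
  have hs : |Real.sin k| < 1 := abs_sin_lt_one_of_cos_ne_zero hk.ne
  have hF := fermiCosJ0_pos ha hs
  have h2F := two_mul_fermiCosJ0_lt ha hs
  have hk' : 0 < -Real.cos k := by linarith
  rw [sqrt_one_sub_sin_sq, abs_of_neg hk, lt_div_iff₀ hk'] at h2F
  have hπ := Real.pi_pos
  rw [liebWuRho0_eq_fermiCosJ0]
  constructor
  · have key : -Real.cos k / π * fermiCosJ0 (U / 2) (Real.sin k) < 1 / (2 * π) := by
      rw [div_mul_eq_mul_div, div_lt_div_iff₀ hπ (by positivity)]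
      nlinarith
    rw [neg_div, neg_mul] at key
    linarith
  · have : 0 < -Real.cos k / π * fermiCosJ0 (U / 2) (Real.sin k) := by positivity
    rw [neg_div, neg_mul] at this
    linarith

/-- **Positivity of Lieb–Wu's momentum density: `ρ₀(k) > 0` for all `k`**, `U > 0`
(Lieb–Wu 2003, Lemma 5; at `cos k = 0`, `ρ₀ = 1/(2π)`). [cite: LiebWuPhysicaA2003, §6 Lemma 5] -/
theorem liebWuRho0_pos {U : ℝ} (hU : 0 < U) (k : ℝ) : 0 < liebWuRho0 U k := by
  rcases lt_trichotomy (Real.cos k) 0 with hk | hk | hk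
  · exact (liebWuRho0_bounds_of_cos_neg hU hk).1
  · rw [liebWuRho0_eq_fermiCosJ0, hk]
    simp
    positivity
  · have := (liebWuRho0_bounds_of_cos_pos hU hk).1
    have : 0 < 1 / (2 * π) := by positivity
    linarith

/-- **Upper bound: `ρ₀(k) < 1/π` for all `k`**, `U > 0`. [cite: LiebWuPhysicaA2003, §6 Lemma 5] -/
theorem liebWuRho0_lt_inv_pi {U : ℝ} (hU : 0 < U) (k : ℝ) : liebWuRho0 U k < 1 / π := by
  have hπ := Real.pi_pos
  have hhalf : 1 / (2 * π) < 1 / π := by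
    rw [div_lt_div_iff₀ (by positivity) hπ]; linarith
  rcases lt_trichotomy (Real.cos k) 0 with hk | hk | hk
  · exact (liebWuRho0_bounds_of_cos_neg hU hk).2.trans hhalf
  · rw [liebWuRho0_eq_fermiCosJ0, hk]
    simpa using hhalf
  · exact (liebWuRho0_bounds_of_cos_pos hU hk).2

/-- The printed form of Lemma 5, first half: for `|k| < π/2`, `1/(2π) < ρ₀(k) < 1/π`.
[cite: LiebWuPhysicaA2003, §6 Lemma 5] -/
theorem liebWuRho0_bounds_of_abs_lt_pi_div_two {U k : ℝ} (hU : 0 < U) (hk : |k| < π / 2) :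
    1 / (2 * π) < liebWuRho0 U k ∧ liebWuRho0 U k < 1 / π :=
  liebWuRho0_bounds_of_cos_pos hU (Real.cos_pos_of_mem_Ioo (by
    constructor <;> linarith [abs_lt.1 hk]))

/-- The printed form of Lemma 5, second half: for `π/2 < |k| ≤ π`, `0 < ρ₀(k) < 1/(2π)`.
[cite: LiebWuPhysicaA2003, §6 Lemma 5] -/
theorem liebWuRho0_bounds_of_pi_div_two_lt_abs {U k : ℝ} (hU : 0 < U) (hk : π / 2 < |k|) (hk' : |k| ≤ π) :
    0 < liebWuRho0 U k ∧ liebWuRho0 U k < 1 / (2 * π) := by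
  refine liebWuRho0_bounds_of_cos_neg hU ?_
  rcases le_or_gt 0 k with h | h
  · rw [abs_of_nonneg h] at hk hk'
    exact Real.cos_neg_of_pi_div_two_lt_of_lt hk (by linarith [Real.pi_pos])
  · rw [abs_of_neg h] at hk hk'
    rw [← Real.cos_neg]
    exact Real.cos_neg_of_pi_div_two_lt_of_lt hk (by linarith [Real.pi_pos])

end Literature.MathematicalPhysics.QuantumLattice
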